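import Literature.NumberTheory.LFunctions.YoshidaWindowSpaces
import HarnessLib

/-!
# `L²`-density of Yoshida's Laurent polynomials `W_N(a) = span{χ_n : |n| ≤ N}` in `L²([−a, a])`

RH-FREE (label, line 1).  Window vocabulary of
`Literature/NumberTheory/LFunctions/YoshidaWindowSpaces.lean` (H. Yoshida, *On Hermitian forms attached
to zeta functions*, Adv. Stud. Pure Math. **21** (1992), §3 p. 289: "`χ_n(x) = (2a)^{-1/2} exp(πinx/a)`
(`|x| ≤ a`) … is an orthonormal basis of `L²([−a, a])`" [cite: Yoshida1992HermitianForms, §3 p. 289]).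
The tree has the orthogonality and the finite-dimensional spaces `W a N = span{χ_n : |n| ≤ N}`
(`YoshidaWindowSpaces`), and uniform convergence of the truncated Fourier series on the smooth class
`K(a)` (`YoshidaWindowFourierSeries`); this file PROVES the completeness half of Yoshida's sentence in
the form used by the `L²` theory of window forms (Connes–Consani, *Spectral triples and ζ-cycles*,
Enseign. Math. 69 (2023), Prop. 2.3: the Laurent polynomials `E = ∪_N E_N` are `L²`-dense in
`L²([λ⁻¹, λ], d*u)`):

* `exists_mem_W_integral_norm_sq_sub_lt`: for `a > 0`, every `ξ ∈ L²(ℝ)` supported in `[−a, a]` and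
  every `ε > 0` admit `N` and `η ∈ W a N` with `∫ |η − ξ|² < ε`;
* `exists_W_seq_tendsto_integral_norm_sq`: hence a sequence `η_n ∈ W a N_n` with `∫ |η_n − ξ|² → 0`.

Proof (Mathlib only, the textbook three-ε argument — e.g. Katznelson, *An Introduction to Harmonic
Analysis*, Ch. I §5, or Yoshida p. 289): truncate `ξ` to `[−a+δ, a−δ]` (monotone convergence), approximate
in `L²` by a continuous compactly supported `g` (Mathlib `MemLp.exists_hasCompactSupport_integral_rpow_sub_le`),
multiply by a continuous cutoff equal to `1` on `[−a+δ, a−δ]` and vanishing near `±a` (this does not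
increase the distance to the truncation), lift the resulting continuous function vanishing at `±a` to the
circle `ℝ/2aℤ` (`AddCircle.liftIco`) and approximate it UNIFORMLY by trigonometric polynomials
(Mathlib `span_fourier_closure_eq_top`, Fejér/Stone–Weierstrass), whose restrictions to the window are
elements of `W a N` (`𝟙_{[−a,a]} e^{2πinx/2a} = (2a)^{1/2} χ_n`).  Theorems only; no definition, no
named fact.  Nothing here bears on the truth of the Riemann hypothesis.
-/

noncomputable section

open Complex Filter Set MeasureTheory
open scoped Real Topology ENNReal

namespace Literature.NumberTheory.LFunctions

namespace Yoshida1992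

variable {a : ℝ}

/-! ## §1 Trigonometric polynomials restricted to the window lie in `W` -/

/-- `𝟙_{[−a,a]}(x) e^{2πinx/(2a)} = (2a)^{1/2} χ_n(x)` lies in `W a N` for `|n| ≤ N` (`a > 0`).
[cite: Yoshida1992HermitianForms, §3 p. 289 (χ_n = (2a)^{-1/2} exp(πinx/a) on |x| ≤ a)] -/
theorem indicator_fourier_mem_W (ha : 0 < a) {N : ℕ} {n : ℤ} (hn : |n| ≤ N) :
    (Icc (-a) a).indicator (fun x : ℝ ↦ @fourier (2 * a) n (x : AddCircle (2 * a))) ∈ W a N := by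
  have hmem : chi a n ∈ W a N := Submodule.subset_span ⟨⟨n, mem_modes.2 hn⟩, rfl⟩
  have hsq : Real.sqrt (2 * a) ≠ 0 := (Real.sqrt_pos.2 (by linarith)).ne'
  have ha' : (a : ℂ) ≠ 0 := by exact_mod_cast ha.ne'
  have e : (Icc (-a) a).indicator (fun x : ℝ ↦ @fourier (2 * a) n (x : AddCircle (2 * a))) =
      ((Real.sqrt (2 * a) : ℝ) : ℂ) • chi a n := by
    funext x
    simp only [Pi.smul_apply, chi, smul_eq_mul]
    by_cases hx : x ∈ Icc (-a) a
    · rw [indicator_of_mem hx, indicator_of_mem hx, chiCore, fourier_coe_apply, ← mul_assoc,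
        ← Complex.ofReal_mul, mul_one_div_cancel hsq, Complex.ofReal_one, one_mul]
      congr 1
      push_cast
      field_simp
    · rw [indicator_of_notMem hx, indicator_of_notMem hx, mul_zero]
  rw [e]
  exact Submodule.smul_mem _ _ hmem

/-- The restriction to the window of a trigonometric polynomial `P ∈ span{e^{2πinx/2a}}` on the circle
`ℝ/2aℤ` is a Laurent polynomial: it lies in some `W a N`. [cite: Yoshida1992HermitianForms, §3 p. 289 (W = span of the χ_n, |n| ≤ N; §0 p. 282)] -/
theorem exists_indicator_comp_mem_W (ha : 0 < a) {P : C(AddCircle (2 * a), ℂ)}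
    (hP : P ∈ Submodule.span ℂ (Set.range (@fourier (2 * a)))) :
    ∃ N : ℕ, (Icc (-a) a).indicator (fun x : ℝ ↦ P (x : AddCircle (2 * a))) ∈ W a N := by
  obtain ⟨c, rfl⟩ := Finsupp.mem_span_range_iff_exists_finsupp.1 hP
  refine ⟨c.support.sup fun n ↦ n.natAbs, ?_⟩
  have e : (Icc (-a) a).indicator
        (fun x : ℝ ↦ (c.sum fun i b ↦ b • @fourier (2 * a) i) (x : AddCircle (2 * a))) =
      ∑ i ∈ c.support, c i •
        (Icc (-a) a).indicator (fun x : ℝ ↦ @fourier (2 * a) i (x : AddCircle (2 * a))) := by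
    funext x
    by_cases hx : x ∈ Icc (-a) a
    · simp [Finsupp.sum, Finset.sum_apply, indicator_of_mem hx]
    · simp [Finset.sum_apply, indicator_of_notMem hx]
  rw [e]
  refine Submodule.sum_mem _ fun i hi ↦ Submodule.smul_mem _ _ (indicator_fourier_mem_W ha ?_)
  have h1 : i.natAbs ≤ c.support.sup fun n ↦ n.natAbs := Finset.le_sup (f := fun n ↦ n.natAbs) hi
  rw [← Int.natCast_natAbs]
  exact_mod_cast h1

/-! ## §2 Uniform approximation on the window by Laurent polynomials (Stone–Weierstrass on `ℝ/2aℤ`) -/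

/-- **Uniform approximation**: a continuous `h : ℝ → ℂ` vanishing for `|x| ≥ a` is, on the window,
uniformly within any `ε > 0` of a Laurent polynomial `η ∈ W a N` (which vanishes off `[−a, a]`): lift
`h` to the circle `ℝ/2aℤ` (`h(−a) = h(a)`) and use the density of trigonometric polynomials in
`C(ℝ/2aℤ)` (Mathlib `span_fourier_closure_eq_top`). [cite: Yoshida1992HermitianForms, §3 p. 289 (Fourier expansion on the window)] -/
theorem exists_mem_W_norm_sub_le (ha : 0 < a) {h : ℝ → ℂ} (hc : Continuous h)
    (h0 : ∀ x, a ≤ |x| → h x = 0) {ε : ℝ} (hε : 0 < ε) :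
    ∃ N : ℕ, ∃ η ∈ W a N, (∀ x, ‖η x - h x‖ ≤ ε) ∧ ∀ x, x ∉ Icc (-a) a → η x = 0 := by
  haveI : Fact (0 < 2 * a) := ⟨by linarith⟩
  have hma : h (-a) = 0 := h0 (-a) (by rw [abs_neg, abs_of_pos ha])
  have hpa : h a = 0 := h0 a (by rw [abs_of_pos ha])
  have hper : h (-a) = h (-a + 2 * a) := by
    rw [hma, show -a + 2 * a = a by ring, hpa]
  set G : C(AddCircle (2 * a), ℂ) :=
    ⟨AddCircle.liftIco (2 * a) (-a) h, AddCircle.liftIco_continuous hper hc.continuousOn⟩ with hG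
  have hGmem : G ∈ (Submodule.span ℂ (Set.range (@fourier (2 * a)))).topologicalClosure := by
    rw [span_fourier_closure_eq_top]; trivial
  have hGcl : G ∈ closure ((Submodule.span ℂ (Set.range (@fourier (2 * a))) :
      Set C(AddCircle (2 * a), ℂ))) := by
    rw [← Submodule.topologicalClosure_coe]; exact hGmem
  obtain ⟨P, hP, hdist⟩ := Metric.mem_closure_iff.1 hGcl ε hε
  obtain ⟨N, hN⟩ := exists_indicator_comp_mem_W ha hP
  refine ⟨N, _, hN, fun x ↦ ?_, fun x hx ↦ indicator_of_notMem hx _⟩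
  have hGx : ∀ y : ℝ, y ∈ Ico (-a) a → G (y : AddCircle (2 * a)) = h y := fun y hy ↦ by
    rw [hG]
    show AddCircle.liftIco (2 * a) (-a) h y = h y
    exact AddCircle.liftIco_coe_apply (by rwa [show -a + 2 * a = a by ring])
  have hPG : ∀ z : AddCircle (2 * a), ‖P z - G z‖ ≤ ε := fun z ↦ by
    rw [← dist_eq_norm, dist_comm]
    exact (ContinuousMap.dist_apply_le_dist z).trans hdist.le
  by_cases hx : x ∈ Icc (-a) a
  · rw [indicator_of_mem hx]
    rcases hx.2.eq_or_lt with hxa | hxa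
    · -- `x = a`: `mk a = mk (−a)` and `h(a) = 0 = h(−a)`
      have hmk : ((a : ℝ) : AddCircle (2 * a)) = ((-a : ℝ) : AddCircle (2 * a)) := by
        have e := AddCircle.coe_add_period (2 * a) (-a)
        rwa [show -a + 2 * a = a by ring] at e
      rw [hxa, hpa, ← hma, hmk, ← hGx (-a) ⟨le_rfl, by linarith⟩]
      exact hPG _
    · rw [← hGx x ⟨hx.1, hxa⟩]
      exact hPG _
  · rw [indicator_of_notMem hx, h0 x, sub_zero, norm_zero]
    · exact hε.le
    · rw [mem_Icc, ← abs_le, not_le] at hx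
      exact hx.le

/-! ## §3 The `L²`-density theorem -/

/-- The piecewise-linear cutoff `κ(x) = max(0, min(1, (a − δ/2 − |x|)/(δ/2)))` (equal to `1` on
`|x| ≤ a − δ`, to `0` on `|x| ≥ a − δ/2`, values in `[0, 1]`) is continuous. [cite: Yoshida1992HermitianForms, §3 p. 289 (plumbing for the density of the χ_n)] -/
private theorem continuous_cutoff (a δ : ℝ) :
    Continuous fun x : ℝ ↦ max 0 (min 1 ((a - δ / 2 - |x|) / (δ / 2))) :=
  continuous_const.max (continuous_const.min ((continuous_const.sub continuous_abs).div_const _))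

/-- `0 ≤ κ`. [cite: Yoshida1992HermitianForms, §3 p. 289 (plumbing for the density of the χ_n)] -/
private theorem cutoff_nonneg (a δ x : ℝ) : 0 ≤ max 0 (min 1 ((a - δ / 2 - |x|) / (δ / 2))) :=
  le_max_left _ _

/-- `κ ≤ 1`. [cite: Yoshida1992HermitianForms, §3 p. 289 (plumbing for the density of the χ_n)] -/
private theorem cutoff_le_one (a δ x : ℝ) : max 0 (min 1 ((a - δ / 2 - |x|) / (δ / 2))) ≤ 1 :=
  max_le zero_le_one (min_le_left _ _)

/-- `κ = 1` on the inner window `|x| ≤ a − δ`. [cite: Yoshida1992HermitianForms, §3 p. 289 (plumbing for the density of the χ_n)] -/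
private theorem cutoff_eq_one {δ x : ℝ} (hδ : 0 < δ) (hx : |x| ≤ a - δ) :
    max 0 (min 1 ((a - δ / 2 - |x|) / (δ / 2))) = 1 := by
  have h1 : 1 ≤ (a - δ / 2 - |x|) / (δ / 2) := by
    rw [le_div_iff₀ (by positivity)]
    linarith
  rw [min_eq_left h1, max_eq_right zero_le_one]

/-- `κ = 0` for `|x| ≥ a − δ/2`. [cite: Yoshida1992HermitianForms, §3 p. 289 (plumbing for the density of the χ_n)] -/
private theorem cutoff_eq_zero {δ x : ℝ} (hδ : 0 < δ) (hx : a - δ / 2 ≤ |x|) :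
    max 0 (min 1 ((a - δ / 2 - |x|) / (δ / 2))) = 0 := by
  have h1 : (a - δ / 2 - |x|) / (δ / 2) ≤ 0 :=
    div_nonpos_iff.2 (Or.inr ⟨by linarith, by positivity⟩)
  rw [max_eq_left ((min_le_right _ _).trans h1)]

/-- `∫ |f|²` is finite for `f ∈ L²`. [cite: Yoshida1992HermitianForms, §3 p. 289 (L²([−a, a]))] -/
private theorem integrable_norm_sq {f : ℝ → ℂ} (hf : MemLp f 2 volume) :
    Integrable fun x ↦ ‖f x‖ ^ 2 :=
  (memLp_two_iff_integrable_sq_norm hf.1).1 hf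

/-- **Truncation**: `∫ |𝟙_{[−a+δ, a−δ]} ξ − ξ|² → 0` as `δ → 0⁺` for `ξ ∈ L²` supported in `[−a, a]`
(monotone convergence; the endpoints are null). [cite: Yoshida1992HermitianForms, §3 p. 289 (L²([−a, a]); plumbing for the density of the χ_n)] -/
theorem exists_truncation_integral_norm_sq_sub_lt (ha : 0 < a) {ξ : ℝ → ℂ}
    (hξ : MemLp ξ 2 volume) (hξs : Function.support ξ ⊆ Icc (-a) a) {ε : ℝ} (hε : 0 < ε) :
    ∃ δ : ℝ, 0 < δ ∧ δ < a ∧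
      ∫ x, ‖(Icc (-a + δ) (a - δ)).indicator ξ x - ξ x‖ ^ 2 < ε := by
  set d : ℕ → ℝ := fun k ↦ a / ((k : ℝ) + 2) with hd
  set s : ℕ → Set ℝ := fun k ↦ Icc (-a + d k) (a - d k) with hs
  have hd_pos : ∀ k, 0 < d k := fun k ↦ by positivity
  have hd_lt : ∀ k, d k < a := fun k ↦ by
    simp only [hd]
    rw [div_lt_iff₀ (by positivity)]
    nlinarith
  have hd_anti : Antitone d := fun k l hkl ↦ by
    simp only [hd]
    gcongr
  have hsm : ∀ k, MeasurableSet (s k) := fun k ↦ measurableSet_Icc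
  have hs_mono : Monotone s := fun k l hkl ↦
    Icc_subset_Icc (by linarith [hd_anti hkl]) (by linarith [hd_anti hkl])
  have hU : (⋃ k, s k) = Ioo (-a) a := by
    ext x
    simp only [mem_iUnion, hs, mem_Icc, mem_Ioo]
    constructor
    · rintro ⟨k, h1, h2⟩
      exact ⟨by linarith [hd_pos k], by linarith [hd_pos k]⟩
    · rintro ⟨h1, h2⟩
      have hm : 0 < min (a - x) (x + a) := lt_min (by linarith) (by linarith)
      obtain ⟨k, hk⟩ := exists_nat_gt (a / min (a - x) (x + a))
      have hdk : d k < min (a - x) (x + a) := by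
        simp only [hd]
        rw [div_lt_iff₀ (by positivity)]
        have h3 : a < min (a - x) (x + a) * k := by
          have := mul_lt_mul_of_pos_left hk hm
          rwa [mul_div_cancel₀ _ hm.ne'] at this
        nlinarith
      exact ⟨k, by linarith [min_le_right (a - x) (x + a)],
        by linarith [min_le_left (a - x) (x + a)]⟩
  have hI := integrable_norm_sq hξ
  have hlim := tendsto_setIntegral_of_monotone hsm hs_mono hI.integrableOn
  rw [hU] at hlim
  have hfull : ∫ x in Ioo (-a) a, ‖ξ x‖ ^ 2 = ∫ x, ‖ξ x‖ ^ 2 := by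
    refine setIntegral_eq_integral_of_ae_compl_eq_zero ?_
    have hae : ∀ᵐ x ∂(volume : Measure ℝ), x ∉ ({-a, a} : Set ℝ) :=
      measure_eq_zero_iff_ae_notMem.1 ((Set.toFinite _).measure_zero _)
    filter_upwards [hae] with x hx hxI
    have hxIcc : x ∉ Icc (-a) a := by
      intro h'
      rcases h'.1.eq_or_lt with h1 | h1
      · exact hx (by simp [← h1])
      · rcases h'.2.eq_or_lt with h2 | h2
        · exact hx (by simp [h2])
        · exact hxI ⟨h1, h2⟩
    have hξx : ξ x = 0 := by
      by_contra hne
      exact hxIcc (hξs (Function.mem_support.2 hne))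
    simp [hξx]
  rw [hfull] at hlim
  have hT : ∀ k, ∫ x, ‖(s k).indicator ξ x - ξ x‖ ^ 2 =
      (∫ x, ‖ξ x‖ ^ 2) - ∫ x in s k, ‖ξ x‖ ^ 2 := by
    intro k
    have hpt : (fun x ↦ ‖(s k).indicator ξ x - ξ x‖ ^ 2) =
        fun x ↦ ‖ξ x‖ ^ 2 - (s k).indicator (fun x ↦ ‖ξ x‖ ^ 2) x := by
      funext x
      by_cases hx : x ∈ s k <;> simp [hx]
    rw [hpt, integral_sub hI (hI.indicator (hsm k)), integral_indicator (hsm k)]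
  have hTlim : Tendsto (fun k ↦ ∫ x, ‖(s k).indicator ξ x - ξ x‖ ^ 2) atTop (𝓝 0) := by
    simp_rw [hT]
    have := (tendsto_const_nhds (x := ∫ x, ‖ξ x‖ ^ 2)).sub hlim
    rwa [sub_self] at this
  obtain ⟨k, hk⟩ := (hTlim.eventually (gt_mem_nhds hε)).exists
  exact ⟨d k, hd_pos k, hd_lt k, hk⟩

/-- **`L²`-density of the Laurent polynomials in `L²([−a, a])`** (the completeness half of "the `χ_n`
form an orthonormal basis of `L²([−a, a])`"): for `a > 0`, `ξ ∈ L²(ℝ)` supported in `[−a, a]` and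
`ε > 0` there are `N` and `η ∈ W a N` with `∫ |η − ξ|² < ε`. [cite: Yoshida1992HermitianForms, §3 p. 289 (the χ_n, n ∈ ℤ, form an orthonormal basis of L²([−a, a]))] -/
theorem exists_mem_W_integral_norm_sq_sub_lt (ha : 0 < a) {ξ : ℝ → ℂ} (hξ : MemLp ξ 2 volume)
    (hξs : Function.support ξ ⊆ Icc (-a) a) {ε : ℝ} (hε : 0 < ε) :
    ∃ N : ℕ, ∃ η ∈ W a N, ∫ x, ‖η x - ξ x‖ ^ 2 < ε := by
  -- Step 1: truncation to `[−a+δ, a−δ]`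
  obtain ⟨δ, hδ, hδa, hT⟩ :=
    exists_truncation_integral_norm_sq_sub_lt ha hξ hξs (ε := ε / 9) (by positivity)
  set ξδ : ℝ → ℂ := (Icc (-a + δ) (a - δ)).indicator ξ with hξδ_def
  have hξδ : MemLp ξδ 2 volume := hξ.indicator measurableSet_Icc
  have hξδ0 : ∀ x, ¬ |x| ≤ a - δ → ξδ x = 0 := fun x hx ↦
    indicator_of_notMem (fun hx' : x ∈ Icc (-a + δ) (a - δ) ↦
      hx (abs_le.2 ⟨by linarith [hx'.1], hx'.2⟩)) _
  -- Step 2: a continuous compactly supported `L²`-approximation of the truncation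
  have hξδ' : MemLp ξδ (ENNReal.ofReal 2) volume := by rwa [ENNReal.ofReal_ofNat]
  obtain ⟨g, hgs, hgε, hgc, hgm⟩ :=
    hξδ'.exists_hasCompactSupport_integral_rpow_sub_le zero_lt_two (ε := ε / 9) (by positivity)
  rw [ENNReal.ofReal_ofNat] at hgm
  have hgε' : ∫ x, ‖ξδ x - g x‖ ^ 2 ≤ ε / 9 := by
    have e : (fun x ↦ ‖ξδ x - g x‖ ^ 2) = fun x ↦ ‖ξδ x - g x‖ ^ (2 : ℝ) :=
      funext fun x ↦ (Real.rpow_two _).symm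
    rwa [e]
  -- Step 3: cutoff near `±a` (does not increase the distance to the truncation)
  set h : ℝ → ℂ := fun x ↦ ((max 0 (min 1 ((a - δ / 2 - |x|) / (δ / 2))) : ℝ) : ℂ) * g x
    with hh_def
  have hhc : Continuous h := (continuous_ofReal.comp (continuous_cutoff a δ)).mul hgc
  have hh0 : ∀ x, a - δ / 2 ≤ |x| → h x = 0 := fun x hx ↦ by
    simp [hh_def, cutoff_eq_zero hδ hx]
  have hpt3 : ∀ x, ‖ξδ x - h x‖ ≤ ‖ξδ x - g x‖ := by
    intro x
    by_cases hx : |x| ≤ a - δ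
    · simp [hh_def, cutoff_eq_one hδ hx]
    · rw [hξδ0 x hx, zero_sub, zero_sub, norm_neg, norm_neg, hh_def]
      simp only
      rw [norm_mul, Complex.norm_real, Real.norm_eq_abs, abs_of_nonneg (cutoff_nonneg a δ x)]
      exact mul_le_of_le_one_left (norm_nonneg _) (cutoff_le_one a δ x)
  -- Step 4: uniform approximation of `h` by a Laurent polynomial
  set ε' : ℝ := Real.sqrt (ε / (36 * a)) with hε'_def
  have hε' : 0 < ε' := Real.sqrt_pos.2 (by positivity)
  have hε'sq : ε' ^ 2 * (2 * a) = ε / 18 := by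
    rw [hε'_def, Real.sq_sqrt (by positivity)]
    field_simp
    ring
  obtain ⟨N, η, hηW, hηh, hη0⟩ :=
    exists_mem_W_norm_sub_le ha hhc (fun x hx ↦ hh0 x (by linarith)) hε'
  refine ⟨N, η, hηW, ?_⟩
  -- Step 5: the three-ε estimate, pointwise then integrated
  have hpt : ∀ x, ‖η x - ξ x‖ ^ 2 ≤
      3 * (‖ξδ x - ξ x‖ ^ 2 + ‖ξδ x - g x‖ ^ 2 + (Icc (-a) a).indicator (fun _ ↦ ε' ^ 2) x) := by
    intro x
    have h3 : ‖η x - h x‖ ^ 2 ≤ (Icc (-a) a).indicator (fun _ ↦ ε' ^ 2) x := by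
      by_cases hx : x ∈ Icc (-a) a
      · rw [indicator_of_mem hx]
        exact pow_le_pow_left₀ (norm_nonneg _) (hηh x) 2
      · have hxa : a < |x| := by
          rw [mem_Icc, ← abs_le, not_le] at hx
          exact hx
        rw [indicator_of_notMem hx, hη0 x hx, hh0 x (by linarith), sub_zero, norm_zero]
        simp
    have htri : ‖η x - ξ x‖ ≤ ‖ξδ x - ξ x‖ + ‖ξδ x - g x‖ + ‖η x - h x‖ := by
      calc ‖η x - ξ x‖ = ‖(ξδ x - ξ x) - (ξδ x - h x) + (η x - h x)‖ := by ring_nf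
        _ ≤ ‖(ξδ x - ξ x) - (ξδ x - h x)‖ + ‖η x - h x‖ := norm_add_le _ _
        _ ≤ ‖ξδ x - ξ x‖ + ‖ξδ x - h x‖ + ‖η x - h x‖ := by
            gcongr
            exact norm_sub_le _ _
        _ ≤ ‖ξδ x - ξ x‖ + ‖ξδ x - g x‖ + ‖η x - h x‖ := by
            gcongr
            exact hpt3 x
    set A := ‖ξδ x - ξ x‖
    set B := ‖ξδ x - g x‖
    set C := ‖η x - h x‖
    have hA : 0 ≤ A := norm_nonneg _
    have hB : 0 ≤ B := norm_nonneg _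
    have hC : 0 ≤ C := norm_nonneg _
    calc ‖η x - ξ x‖ ^ 2 ≤ (A + B + C) ^ 2 := pow_le_pow_left₀ (norm_nonneg _) htri 2
      _ ≤ 3 * (A ^ 2 + B ^ 2 + C ^ 2) := by
          nlinarith [sq_nonneg (A - B), sq_nonneg (B - C), sq_nonneg (A - C)]
      _ ≤ 3 * (A ^ 2 + B ^ 2 + (Icc (-a) a).indicator (fun _ ↦ ε' ^ 2) x) := by linarith [h3]
  have hI1 : Integrable fun x ↦ ‖ξδ x - ξ x‖ ^ 2 := integrable_norm_sq (hξδ.sub hξ)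
  have hI2 : Integrable fun x ↦ ‖ξδ x - g x‖ ^ 2 := integrable_norm_sq (hξδ.sub hgm)
  have hI3 : Integrable ((Icc (-a) a).indicator fun _ : ℝ ↦ ε' ^ 2) := by
    refine IntegrableOn.integrable_indicator ?_ measurableSet_Icc
    exact integrableOn_const (by rw [Real.volume_Icc]; exact ENNReal.ofReal_ne_top)
  have hvol : ∫ x, (Icc (-a) a).indicator (fun _ : ℝ ↦ ε' ^ 2) x = ε' ^ 2 * (2 * a) := by
    rw [integral_indicator_const _ measurableSet_Icc, Measure.real, Real.volume_Icc,
      ENNReal.toReal_ofReal (by linarith), smul_eq_mul]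
    ring
  calc ∫ x, ‖η x - ξ x‖ ^ 2
      ≤ ∫ x, 3 * (‖ξδ x - ξ x‖ ^ 2 + ‖ξδ x - g x‖ ^ 2 +
          (Icc (-a) a).indicator (fun _ ↦ ε' ^ 2) x) :=
        integral_mono_of_nonneg (Eventually.of_forall fun _ ↦ by positivity)
          (((hI1.add hI2).add hI3).const_mul 3) (Eventually.of_forall hpt)
    _ = 3 * ((∫ x, ‖ξδ x - ξ x‖ ^ 2) + (∫ x, ‖ξδ x - g x‖ ^ 2) + ε' ^ 2 * (2 * a)) := by
        have hI12 : Integrable fun x ↦ ‖ξδ x - ξ x‖ ^ 2 + ‖ξδ x - g x‖ ^ 2 := hI1.add hI2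
        rw [integral_const_mul, integral_add hI12 hI3, integral_add hI1 hI2, hvol]
    _ < ε := by
        rw [hε'sq]
        linarith

/-- **Sequence form**: every `ξ ∈ L²(ℝ)` supported in `[−a, a]` (`a > 0`) is the `L²`-limit of a
sequence of Laurent polynomials `η_n ∈ W a N_n`. [cite: Yoshida1992HermitianForms, §3 p. 289 (the χ_n form an orthonormal basis of L²([−a, a]))] -/
theorem exists_W_seq_tendsto_integral_norm_sq (ha : 0 < a) {ξ : ℝ → ℂ} (hξ : MemLp ξ 2 volume)
    (hξs : Function.support ξ ⊆ Icc (-a) a) :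
    ∃ η : ℕ → ℝ → ℂ, (∀ n, ∃ N : ℕ, η n ∈ W a N) ∧
      Tendsto (fun n ↦ ∫ x, ‖η n x - ξ x‖ ^ 2) atTop (𝓝 0) := by
  have hex : ∀ n : ℕ, ∃ η : ℝ → ℂ, (∃ N : ℕ, η ∈ W a N) ∧
      ∫ x, ‖η x - ξ x‖ ^ 2 < 1 / ((n : ℝ) + 1) := by
    intro n
    obtain ⟨N, η, hη, hlt⟩ :=
      exists_mem_W_integral_norm_sq_sub_lt ha hξ hξs (ε := 1 / ((n : ℝ) + 1)) (by positivity)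
    exact ⟨η, ⟨N, hη⟩, hlt⟩
  choose η hηW hηlt using hex
  refine ⟨η, hηW, ?_⟩
  exact squeeze_zero (fun n ↦ integral_nonneg fun _ ↦ by positivity) (fun n ↦ (hηlt n).le)
    tendsto_one_div_add_atTop_nhds_zero_nat

end Yoshida1992

end Literature.NumberTheory.LFunctions

end
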